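import Literature.Geometry.Riemannian.HeatBarrierSubsolutionFamily
import Literature.Geometry.Riemannian.DirectionalBarrierChainRule
import Literature.Geometry.Riemannian.DistanceLaplacianComparisonSphere
import Literature.Geometry.Riemannian.AlmostAntipodalExcess
import Literature.Geometry.Riemannian.DistSqDirectionalDatum
import Literature.Geometry.Riemannian.CutTimeCutLocus
import HarnessLib

/-!
# `cos d_p` is a barrier sub-solution of `Δ + m` under `Ric ≥ m - 1`, and the heat flow
# monotonicity `e^{mτ} P_τ cos d_p ↑`

The smoothing step of Colding's proof of the volume sphere theorem
(`Colding1996_volume_ghClose`; Colding 1996a, §1, Colding 1997, sketch of the proof of Thm. 1.1: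
"`cos d(p, ·)` is almost a solution of `Δ f = -n f`") run through the heat flow of the FIXED
metric `g` (the constant family `r ↦ g` of the tree's heat library): under `Ric ≥ (m-1) g` on a
closed `m`-manifold the function `u = cos d(p, ·)` satisfies `Δ u ≥ -m u` in the directional
barrier sense at EVERY point (Laplacian comparison `Δ r ≤ (m-1) cot r`, `far_end_sin_datum`, at
`0 < d(p, y) < π`; the exact barrier `cos σ` at `y = p`; and at an antipode `d(p, y) = π` the zero
excess `d(p, ·) + d(·, y) = π` of `excess_pow_le_of_edist_ge_pi_sub` turns `cos d_p = -cos d_y`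
into the exact barrier `-cos σ`), hence `w(y, r) = e^{-m(r - s₁)} cos d(p, y)` is a barrier
sub-solution of the heat equation and the domination principle
`integral_heatKernelMeasure_le_of_directionalBarrier_family` gives, for the heat kernel measures
`ν_{x,t;s}` of the static family and `s₁ < s₂ < t`,
  `e^{-m(s₂ - s₁)} ∫ cos d_p dν_{x,t;s₂} ≤ ∫ cos d_p dν_{x,t;s₁}`,
i.e. `τ ↦ e^{mτ} (P_τ cos d_p)(x)` is nondecreasing — the integrated form of
`(Δ + m) P_τ cos d_p ≥ 0`.

* `eventually_edist_expMap_smul_eq_abs` — short geodesics minimize: `d(y, exp_y(σ e)) = |σ|` for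
  `σ` near `0`, `e` a unit vector;
* `far_end_edist_barriers_sin` — the datum of `far_end_sin_datum` as `Fin (dim M)`-indexed
  polynomial upper barriers of `d(p, ·)` at the far end of a unit speed geodesic of length
  `T ∈ (0, π)`, exact first derivatives (`1` radially, `0` transversally) and
  `Σ bᵢ ≤ (dim M − 1) cot T + ε₁`;
* `cosClamp`, `antitone_cosClamp`, … — the clamped cosine `cos (max 0 (min r π))` (globally
  nonincreasing, `= cos` on `[0, π]`);
* `cos_edist_heat_directional_datum` — the lower barrier datum of
  `e^{-m(t - t₁)} cos d(p, ·)` at every `(y, t)` in the format of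
  `integral_heatKernelMeasure_le_of_directionalBarrier_family` (`c = 0`);
* **`exp_mul_integral_cos_edist_heatKernelMeasure_le`** — the monotonicity above.

Everything here is proved; no definitions of notions beyond the auxiliary `cosClamp`, no named
facts (D-0026).

## References

* T. H. Colding, *Shape of manifolds with positive Ricci curvature*, Invent. Math. 124 (1996)
  175–191, §1 (Lemma 1.4 ff.). [Colding1996Shape]
* T. H. Colding, *Aspects of Ricci curvature*, in *Comparison Geometry* (1997), §1, sketch of the
  proof of Thm. 1.1. [Colding1997Aspects]
* R. H. Bamler, *Entropy and heat kernel bounds on a Ricci flow background* (2020), §2.3 and §9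
  (barrier sub-solutions are dominated by the heat kernel). [Bamler2020Entropy]
* J. M. Lee, *Introduction to Riemannian Manifolds*, 2nd ed. (2018), Prop. 6.11, Thm. 11.15.
  [LeeRiemannianManifolds2018]
-/

noncomputable section

open Set Function Filter MeasureTheory
open scoped Manifold ContDiff Topology ENNReal NNReal Real

namespace Literature.Geometry.Riemannian

open Lorentzian Lorentzian.PseudoRiemannianMetric

/-! ### §1 Short geodesics minimize; the far-end datum with `Fin`-indexed barriers -/

section FarEnd

variable {E : Type*} [NormedAddCommGroup E] [NormedSpace ℝ E] [FiniteDimensional ℝ E]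
  [CompleteSpace E] {M : Type*} [TopologicalSpace M] [ChartedSpace E M] [IsManifold 𝓘(ℝ, E) ∞ M]
  [T2Space M]
  (g : PseudoRiemannianMetric 𝓘(ℝ, E) ∞ E (TangentSpace 𝓘(ℝ, E) : M → Type _)) [g.HasLeviCivita]
  [CovariantDerivative.ContMDiffCovariantDerivative g.leviCivita 1]

/-- **Short geodesics minimize** (Lee 2018, Prop. 6.11: inside a normal ball the radial geodesics
are the unique minimizers; here through the positivity of the cut time,
`exists_pos_le_cutTime`): for a `g`-unit vector `e` at `y` and `σ` near `0`,
`d(y, exp_y(σ e)) = |σ|`. [cite: LeeRiemannianManifolds2018, Prop. 6.11] -/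
theorem eventually_edist_expMap_smul_eq_abs (hg : g.IsRiemannian)
    (hc : IsGeodesicallyComplete g.leviCivita) (y : M) (e : TangentSpace 𝓘(ℝ, E) y)
    (he : g.val y e e = 1) :
    ∀ᶠ σ in 𝓝 (0 : ℝ), (g.edist hg y (expMap g.leviCivita y (σ • e))).toReal = |σ| := by
  haveI : Fact ((1 : ℕ∞ω) ≤ ((⊤ : ℕ∞) : ℕ∞ω)) := ⟨by exact_mod_cast le_top⟩
  obtain ⟨ε, hε, hmin⟩ := exists_pos_le_cutTime g le_rfl hg hc y
  have hne : g.val y (-e) (-e) = 1 := by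
    simp only [map_neg, FunLike.coe_neg, Pi.neg_apply, neg_neg]
    exact he
  filter_upwards [Ioo_mem_nhds (neg_lt_zero.2 hε) hε] with σ hσ
  rcases le_or_gt 0 σ with h0 | h0
  · have h1 := (isMinimizingUpTo_iff_edist g hg hc y (v := e) he σ).1 ((hmin e he).1 σ h0 hσ.2)
    rw [← expMap_smul hc y (show TangentSpace 𝓘(ℝ, E) y from e) σ] at h1
    have h1' : g.edist hg y (expMap g.leviCivita y (σ • e)) = ENNReal.ofReal σ := h1
    rw [h1', ENNReal.toReal_ofReal h0, abs_of_nonneg h0]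
  · have h1 := (isMinimizingUpTo_iff_edist g hg hc y (v := -e) hne (-σ)).1
      ((hmin (-e) hne).1 (-σ) (by linarith) (by linarith [hσ.1]))
    rw [← expMap_smul hc y (show TangentSpace 𝓘(ℝ, E) y from -e) (-σ)] at h1
    have h2 : (-σ) • (show TangentSpace 𝓘(ℝ, E) y from -e) = σ • e := by
      show (-σ) • (-e) = σ • e
      rw [smul_neg, neg_smul, neg_neg]
    rw [h2] at h1
    have h1' : g.edist hg y (expMap g.leviCivita y (σ • e)) = ENNReal.ofReal (-σ) := h1
    rw [h1', ENNReal.toReal_ofReal (by linarith), abs_of_neg h0]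

variable [CovariantDerivative.ContMDiffCovariantDerivative g.leviCivita ∞]

/-- **Spatial directional barriers for `d(p, ·)` at the far end `y₀ = exp_p(Tu)` of a unit speed
geodesic under `Ric ≥ (dim M − 1) g`, `0 < T < π`** (`far_end_sin_datum` re-indexed by
`Fin (dim M)`): a `g`-orthonormal frame `e` at `y₀`, polynomial upper barriers
`Bᵢ(σ) ≥ d(p, exp_{y₀}(σ eᵢ))` for `σ` near `0` with `Bᵢ(0) = T` (the radial barrier `T + σ`, the
transverse ones `T + qₒσ²`), derivatives `Bᵢ′` with `B′_{i₀}(0) = 1`, `Bᵢ′(0) = 0` (`i ≠ i₀`),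
second derivatives `bᵢ` at `0`, and `Σᵢ bᵢ ≤ (dim M − 1) cot T + ε₁` — "`Δ r ≤ (m−1) cot r` in the
barrier sense". [cite: LeeRiemannianManifolds2018, Thm. 11.15] -/
theorem far_end_edist_barriers_sin (hg : g.IsRiemannian) (hc : IsGeodesicallyComplete g.leviCivita)
    (hRic : ∀ (x : M) (w : TangentSpace 𝓘(ℝ, E) x),
      ((Module.finrank ℝ E : ℝ) - 1) * g.val x w w ≤ g.leviCivita.ricci x w w)
    (p : M) (u : TangentSpace 𝓘(ℝ, E) p) (hu : g.val p u u = 1) {T : ℝ} (hT : 0 < T)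
    (hTπ : T < π) {ε₁ : ℝ} (hε₁ : 0 < ε₁) :
    ∃ (e : Fin (Module.finrank ℝ E) → TangentSpace 𝓘(ℝ, E) (expMap g.leviCivita p (T • u)))
      (B B' : Fin (Module.finrank ℝ E) → ℝ → ℝ) (b : Fin (Module.finrank ℝ E) → ℝ)
      (i₀ : Fin (Module.finrank ℝ E)),
      (∀ i j, g.val (expMap g.leviCivita p (T • u)) (e i) (e j) = if i = j then 1 else 0) ∧
      (∀ i, (∀ᶠ σ in 𝓝 (0 : ℝ), HasDerivAt (B i) (B' i σ) σ) ∧ HasDerivAt (B' i) (b i) 0 ∧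
        B i 0 = T ∧
        ∀ᶠ σ in 𝓝 (0 : ℝ), (g.edist hg p
          (expMap g.leviCivita (expMap g.leviCivita p (T • u)) (σ • e i))).toReal ≤ B i σ) ∧
      B' i₀ 0 = 1 ∧ (∀ i, i ≠ i₀ → B' i 0 = 0) ∧
      ∑ i, b i ≤ ((Module.finrank ℝ E : ℝ) - 1) * (Real.cos T / Real.sin T) + ε₁ := by
  classical
  obtain ⟨k, f, Q, hcard, hon, -, hrad, hbar, hQ⟩ := far_end_sin_datum g hg hc hRic p u hu hT hTπ
  -- the inner slack: `k ε T ≤ ε₁`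
  set ε : ℝ := ε₁ / (((k : ℝ) + 1) * (T + 1)) with hε_def
  have hε : 0 < ε := by positivity
  -- reindexing `Fin (dim M) ≃ Option (Fin k)`
  have hcardF : Fintype.card (Fin (Module.finrank ℝ E)) = Fintype.card (Option (Fin k)) := by
    rw [Fintype.card_fin, hcard]
  set ι : Fin (Module.finrank ℝ E) ≃ Option (Fin k) := Fintype.equivOfCardEq hcardF with hι
  -- the barriers per direction `o`
  set q : Option (Fin k) → ℝ := fun o ↦ (Q o + ε * T) / 2 with hq
  set Bq : Option (Fin k) → ℝ → ℝ := fun o σ ↦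
    if o = none then T + σ else T + q o * σ ^ 2 with hBq
  set Bq' : Option (Fin k) → ℝ → ℝ := fun o σ ↦
    if o = none then 1 else 2 * q o * σ with hBq'
  set bq : Option (Fin k) → ℝ := fun o ↦ if o = none then 0 else 2 * q o with hbq
  have hBd : ∀ o σ, HasDerivAt (Bq o) (Bq' o σ) σ := by
    intro o σ
    by_cases ho : o = none
    · have h1 : HasDerivAt (fun x : ℝ ↦ T + x) 1 σ := (hasDerivAt_id' σ).const_add T
      have e1 : Bq o = fun x : ℝ ↦ T + x := by funext x; simp [hBq, ho]
      have e2 : Bq' o σ = 1 := by simp [hBq', ho]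
      rw [e1, e2]; exact h1
    · have h1 : HasDerivAt (fun x : ℝ ↦ T + q o * x ^ 2) (2 * q o * σ) σ :=
        (((hasDerivAt_pow 2 σ).const_mul (q o)).const_add T).congr_deriv (by ring)
      have e1 : Bq o = fun x : ℝ ↦ T + q o * x ^ 2 := by funext x; simp [hBq, ho]
      have e2 : Bq' o σ = 2 * q o * σ := by simp [hBq', ho]
      rw [e1, e2]; exact h1
  have hB'd : ∀ o, HasDerivAt (Bq' o) (bq o) 0 := by
    intro o
    by_cases ho : o = none
    · have h1 : HasDerivAt (fun _ : ℝ ↦ (1 : ℝ)) 0 0 := hasDerivAt_const 0 1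
      have e1 : Bq' o = fun _ : ℝ ↦ (1 : ℝ) := by funext x; simp [hBq', ho]
      have e2 : bq o = 0 := by simp [hbq, ho]
      rw [e1, e2]; exact h1
    · have h1 : HasDerivAt (fun x : ℝ ↦ 2 * q o * x) (2 * q o) 0 := by
        simpa using (hasDerivAt_id' (0 : ℝ)).const_mul (2 * q o)
      have e1 : Bq' o = fun x : ℝ ↦ 2 * q o * x := by funext x; simp [hBq', ho]
      have e2 : bq o = 2 * q o := by simp [hbq, ho]
      rw [e1, e2]; exact h1
  have hB0 : ∀ o, Bq o 0 = T := by
    intro o; by_cases ho : o = none <;> simp [hBq, ho]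
  have hB'0 : ∀ o, Bq' o 0 = if o = none then 1 else 0 := by
    intro o; by_cases ho : o = none <;> simp [hBq', ho]
  -- domination
  have hdom : ∀ o, ∀ᶠ σ in 𝓝 (0 : ℝ), (g.edist hg p
      (expMap g.leviCivita (expMap g.leviCivita p (T • u)) (σ • f o))).toReal ≤ Bq o σ := by
    intro o
    by_cases ho : o = none
    · subst ho
      filter_upwards [Ioo_mem_nhds (show -T < 0 by linarith) hT] with σ hσ
      simp only [hBq, if_true]
      exact hrad σ hσ
    · filter_upwards [hbar o ε hε] with σ h1
      simp only [ho, if_false, add_zero] at h1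
      simp only [hBq, ho, if_false, hq]
      exact h1
  -- the sum of the second derivatives
  have hsumb : ∑ o, bq o = ((∑ o, Q o) - Q none) + (k : ℝ) * (ε * T) := by
    rw [Fintype.sum_option, Fintype.sum_option]
    simp only [hbq, if_true, Option.some_ne_none, if_false, hq]
    rw [show ∑ x : Fin k, 2 * ((Q (some x) + ε * T) / 2) = ∑ x : Fin k, (Q (some x) + ε * T) from
      Finset.sum_congr rfl fun x _ ↦ by ring, Finset.sum_add_distrib, Finset.sum_const,
      Finset.card_univ, Fintype.card_fin, nsmul_eq_mul]
    ring
  have hslack : (k : ℝ) * (ε * T) ≤ ε₁ := by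
    have hk0 : 0 ≤ (k : ℝ) := Nat.cast_nonneg k
    have e1 : (k : ℝ) * (ε * T) = ε₁ * ((k : ℝ) / ((k : ℝ) + 1)) * (T / (T + 1)) := by
      rw [hε_def]; field_simp
    rw [e1]
    have h2 : (k : ℝ) / ((k : ℝ) + 1) ≤ 1 := by rw [div_le_one (by positivity)]; linarith
    have h3 : T / (T + 1) ≤ 1 := by rw [div_le_one (by positivity)]; linarith
    have h4 : 0 ≤ (k : ℝ) / ((k : ℝ) + 1) := by positivity
    have h5 : 0 ≤ T / (T + 1) := by positivity
    calc ε₁ * ((k : ℝ) / ((k : ℝ) + 1)) * (T / (T + 1)) ≤ ε₁ * 1 * 1 := by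
          gcongr
      _ = ε₁ := by ring
  -- assembly
  refine ⟨fun i ↦ f (ι i), fun i ↦ Bq (ι i), fun i ↦ Bq' (ι i), fun i ↦ bq (ι i), ι.symm none,
    fun i j ↦ ?_, fun i ↦ ⟨Eventually.of_forall fun σ ↦ hBd _ σ, hB'd _, hB0 _, hdom _⟩, ?_, ?_, ?_⟩
  · simp only [hon, EmbeddingLike.apply_eq_iff_eq]
  · simp only [hB'0, Equiv.apply_symm_apply, if_true]
  · intro i hi
    have hι' : ι i ≠ none := fun h ↦ hi (by rw [← h, Equiv.symm_apply_apply])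
    simp only [hB'0, hι', if_false]
  · rw [Fintype.sum_equiv ι (fun i ↦ bq (ι i)) bq (fun i ↦ rfl), hsumb]
    linarith [hQ, hslack]

end FarEnd

/-! ### §2 The clamped cosine `cos (max 0 (min r π))` -/

section Clamp

/-- `r ↦ cos (max 0 (min r π))` is nonincreasing on `ℝ` (`cos` is nonincreasing on `[0, π]` and
the clamp `r ↦ max 0 (min r π)` is nondecreasing with values in `[0, π]`). [folklore] -/
theorem antitone_cos_clamp : Antitone fun r : ℝ ↦ Real.cos (max 0 (min r π)) := by
  intro a b hab
  exact Real.cos_le_cos_of_nonneg_of_le_pi (le_max_left _ _)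
    (max_le Real.pi_pos.le (min_le_right _ _)) (max_le_max le_rfl (min_le_min hab le_rfl))

/-- On `[0, π]` the clamped cosine is the cosine. [folklore] -/
theorem cos_clamp_of_mem {r : ℝ} (hr : r ∈ Icc 0 π) : Real.cos (max 0 (min r π)) = Real.cos r := by
  rw [min_eq_left hr.2, max_eq_right hr.1]

/-- Near a point of `(0, π)` the clamped cosine is the cosine. [folklore] -/
theorem cos_clamp_eventuallyEq {T : ℝ} (hT : 0 < T) (hTπ : T < π) :
    (fun r : ℝ ↦ Real.cos (max 0 (min r π))) =ᶠ[𝓝 T] Real.cos :=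
  eventuallyEq_of_mem (Ioo_mem_nhds hT hTπ) fun _ hr ↦ cos_clamp_of_mem (Ioo_subset_Icc_self hr)

end Clamp

/-! ### §3 The directional datum of `e^{-m(t-t₁)} cos d_p` and the heat flow monotonicity -/

section Static

variable {m : ℕ} {M : Type*} [TopologicalSpace M] [T2Space M] [SecondCountableTopology M]
  [ChartedSpace (EuclideanSpace ℝ (Fin m)) M] [IsManifold (𝓡 m) ∞ M]
  [MeasurableSpace M] [BorelSpace M]
  (g : PseudoRiemannianMetric (𝓡 m) ∞ (EuclideanSpace ℝ (Fin m)) (TangentSpace (𝓡 m) : M → Type _))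
  [ConnectedSpace M] [CompactSpace M] [g.HasLeviCivita]

/-- **`cos d_p` is a barrier sub-solution of `Δ + m`; the directional datum of
`u(y, t) = e^{-m(t - t₁)} cos d(p, y)`** (closed `m`-manifold, `m ≥ 2`, `Ric ≥ (m-1) g`; Colding
1996a, §1 / Colding 1997, sketch of the proof of Thm. 1.1: "`Δ cos r ≥ -n cos r`", in the format
of `integral_heatKernelMeasure_le_of_directionalBarrier_family` with `c = 0`): at every `(y, t)`
and for every `η > 0`, a `g`-orthonormal frame `e` at `y`, one-variable LOWER barriers
`Uᵢ(σ) ≤ u(exp_y(σ eᵢ), t)` near `σ = 0`, touching, with second derivatives `buᵢ` at `0`, the time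
barrier `u(y, ·)` itself with derivative `pu`, and `pu − Σᵢ buᵢ ≤ η`. Three cases: at a generic
point `0 < d(p, y) < π` this is the chain rule `directional_lower_barriers_of_antitone_comp`
(`Φ = cos` clamped to `[0, π]`, `λ = m`, `S = (m-1) cot d(p, y)`: `sin r (m-1) cot r + cos r =
m cos r`) applied to the Laplacian comparison datum `far_end_edist_barriers_sin`; at `y = p` the
exact barriers `c cos σ` (`d(p, exp_p(σe)) = |σ|`); at an antipode `d(p, y) = π` (all distances are
`≤ π` by Myers) the zero excess `d(p, ·) = π − d(y, ·)` (`excess_pow_le_of_edist_ge_pi_sub` with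
`δ = 0`) and `d(y, exp_y(σe)) = |σ|` give the exact barriers `-c cos σ`.
[cite: Colding1997Aspects, §1, sketch of proof of Thm. 1.1] [cite: Colding1996Shape, §1] -/
theorem cos_edist_heat_directional_datum (hg : g.IsRiemannian) (hm : 2 ≤ m)
    (hRic : ∀ (x : M) (w : TangentSpace (𝓡 m) x), ((m : ℝ) - 1) * g.val x w w ≤ g.ricci x w w)
    (p : M) (t₁ : ℝ) (y : M) (t : ℝ) {η : ℝ} (hη : 0 < η) :
    ∃ (e : Fin (Module.finrank ℝ (EuclideanSpace ℝ (Fin m))) → TangentSpace (𝓡 m) y)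
      (U U' : Fin (Module.finrank ℝ (EuclideanSpace ℝ (Fin m))) → ℝ → ℝ)
      (bu : Fin (Module.finrank ℝ (EuclideanSpace ℝ (Fin m))) → ℝ) (Ut : ℝ → ℝ) (pu : ℝ),
      (∀ i j, g.val y (e i) (e j) = if i = j then 1 else 0) ∧
      (∀ i, (∀ᶠ σ in 𝓝 (0 : ℝ), HasDerivAt (U i) (U' i σ) σ) ∧ HasDerivAt (U' i) (bu i) 0 ∧
        U i 0 = Real.exp (-(m : ℝ) * (t - t₁)) * Real.cos (g.edist hg p y).toReal ∧
        ∀ᶠ σ in 𝓝 (0 : ℝ), U i σ ≤ Real.exp (-(m : ℝ) * (t - t₁)) *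
          Real.cos (g.edist hg p (expMap g.leviCivita y (σ • e i))).toReal) ∧
      (HasDerivWithinAt Ut pu (Iic t) t ∧
        Ut t = Real.exp (-(m : ℝ) * (t - t₁)) * Real.cos (g.edist hg p y).toReal ∧
        ∀ᶠ t' in 𝓝[<] t,
          Ut t' ≤ Real.exp (-(m : ℝ) * (t' - t₁)) * Real.cos (g.edist hg p y).toReal) ∧
      pu - ∑ i, bu i ≤ 0 + η := by
  classical
  haveI : Fact ((1 : ℕ∞ω) ≤ ((⊤ : ℕ∞) : ℕ∞ω)) := ⟨by exact_mod_cast le_top⟩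
  have h2 : (2 : ℕ∞ω) ≤ ((⊤ : ℕ∞) : ℕ∞ω) := WithTop.coe_le_coe.mpr le_top
  haveI : CovariantDerivative.ContMDiffCovariantDerivative g.leviCivita 1 :=
    contMDiffCovariantDerivative_leviCivita_of_two_le g h2
  haveI : CovariantDerivative.ContMDiffCovariantDerivative g.leviCivita ((⊤ : ℕ∞) : ℕ∞ω) :=
    contMDiffCovariantDerivative_leviCivita_infty g le_rfl
  haveI : LocallyCompactSpace M := Manifold.locallyCompact_of_finiteDimensional (𝓡 m)
  haveI : T3Space M := inferInstance
  have hc : IsGeodesicallyComplete g.leviCivita := isGeodesicallyComplete_of_compactSpace g h2 hg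
  have hfinE : Module.finrank ℝ (EuclideanSpace ℝ (Fin m)) = m := finrank_euclideanSpace_fin
  have hfr : ((Module.finrank ℝ (EuclideanSpace ℝ (Fin m)) : ℕ) : ℝ) = m := by
    exact_mod_cast hfinE
  have hm0 : 0 < m := by omega
  have hRic' : ∀ (x : M) (w : TangentSpace (𝓡 m) x),
      ((Module.finrank ℝ (EuclideanSpace ℝ (Fin m)) : ℝ) - 1) * g.val x w w ≤
        g.leviCivita.ricci x w w := by
    intro x w
    rw [hfinE]
    exact hRic x w
  -- Myers: all distances are `≤ π`
  have hle_pi : ∀ y z : M, (g.edist hg y z).toReal ≤ π := by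
    intro y z
    have h := edist_le_pi_div_sqrt_of_ricci_ge_of_compactSpace g hg (by rw [hfinE]; exact hm)
      one_pos (fun y w ↦ by rw [hfinE, mul_one]; exact hRic y w) y z
    rw [Real.sqrt_one, div_one] at h
    exact ENNReal.toReal_le_of_le_ofReal Real.pi_pos.le h
  have hd0 : ∀ y z : M, 0 ≤ (g.edist hg y z).toReal := fun _ _ ↦ ENNReal.toReal_nonneg
  -- the constant `c = e^{-m(t-t₁)}` and the derivative of the time factor
  set c : ℝ := Real.exp (-(m : ℝ) * (t - t₁)) with hc_def
  have hc0 : 0 < c := Real.exp_pos _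
  have hder : HasDerivAt (fun t' ↦ Real.exp (-(m : ℝ) * (t' - t₁))) (c * (-(m : ℝ) * 1)) t :=
    (((hasDerivAt_id t).sub_const t₁).const_mul (-(m : ℝ))).exp
  rcases eq_or_ne p y with hpy | hpy
  · /- ### at the base point: the barriers `c cos σ` -/
    subst hpy
    have hT0 : (g.edist hg p p).toReal = 0 := by
      rw [PseudoRiemannianMetric.edist_self]; simp
    obtain ⟨b, hb⟩ := g.exists_orthonormal_basis p hg
    have hcosd : ∀ i, ∀ᶠ σ in 𝓝 (0 : ℝ),
        Real.cos (g.edist hg p (expMap g.leviCivita p (σ • b i))).toReal = Real.cos σ := by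
      intro i
      filter_upwards [eventually_edist_expMap_smul_eq_abs g hg hc p (b i) (by rw [hb]; simp)]
        with σ hσ
      rw [hσ, Real.cos_abs]
    have hU1 : ∀ σ : ℝ, HasDerivAt (fun σ ↦ c * Real.cos σ) (-c * Real.sin σ) σ := fun σ ↦
      ((Real.hasDerivAt_cos σ).const_mul c).congr_deriv (by ring)
    have hU2 : HasDerivAt (fun σ ↦ -c * Real.sin σ) (-c) 0 := by
      simpa using (Real.hasDerivAt_sin (0 : ℝ)).const_mul (-c)
    have hUt : HasDerivWithinAt
        (fun t' ↦ Real.exp (-(m : ℝ) * (t' - t₁)) * Real.cos (g.edist hg p p).toReal)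
        (-(m : ℝ) * c) (Iic t) t := by
      refine ((hder.mul_const (Real.cos (g.edist hg p p).toReal)).hasDerivWithinAt
        (s := Iic t)).congr_deriv ?_
      rw [hT0, Real.cos_zero]
      ring
    refine ⟨fun i ↦ b i, fun _ σ ↦ c * Real.cos σ, fun _ σ ↦ -c * Real.sin σ, fun _ ↦ -c,
      fun t' ↦ Real.exp (-(m : ℝ) * (t' - t₁)) * Real.cos (g.edist hg p p).toReal, -(m : ℝ) * c,
      hb, fun i ↦ ⟨Eventually.of_forall hU1, hU2, by simp only [hT0, Real.cos_zero], ?_⟩,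
      ⟨hUt, rfl, Eventually.of_forall fun t' ↦ le_rfl⟩, ?_⟩
    · filter_upwards [hcosd i] with σ hσ
      rw [hσ]
    · simp only [Finset.sum_const, Finset.card_univ, Fintype.card_fin, nsmul_eq_mul, hfr]
      linarith
  · have hT0 : 0 < (g.edist hg p y).toReal := by
      letI := g.metricSpace hg
      exact dist_pos.2 hpy
    rcases (hle_pi p y).lt_or_eq with hTπ | hTπ
    · /- ### the generic point `0 < d(p, y) < π`: chain rule on the far-end datum -/
      obtain ⟨u, T, hTpos, hu, hyTu, hT⟩ := exists_unit_minimizing g hg hc hpy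
      subst hyTu
      have hTπ' : T < π := hT ▸ hTπ
      have hsin : 0 < Real.sin T := Real.sin_pos_of_pos_of_lt_pi hTpos hTπ'
      -- the clamped cosine near `T`
      set Φ : ℝ → ℝ := fun r ↦ Real.cos (max 0 (min r π)) with hΦ_def
      have hΦd : ∀ z : M, Φ (g.edist hg p z).toReal = Real.cos (g.edist hg p z).toReal :=
        fun z ↦ cos_clamp_of_mem ⟨hd0 p z, hle_pi p z⟩
      have hΦT : Φ T = Real.cos T := cos_clamp_of_mem ⟨hTpos.le, hTπ'.le⟩
      have hΦ1 : ∀ᶠ q in 𝓝 ((fun (z : M) (_ : ℝ) ↦ (g.edist hg p z).toReal)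
          (expMap g.leviCivita p (T • u)) t), HasDerivAt Φ ((fun q ↦ -Real.sin q) q) q := by
        show ∀ᶠ q in 𝓝 (g.edist hg p (expMap g.leviCivita p (T • u))).toReal,
          HasDerivAt Φ (-Real.sin q) q
        rw [hT]
        filter_upwards [Ioo_mem_nhds hTpos hTπ'] with q hq
        exact (Real.hasDerivAt_cos q).congr_of_eventuallyEq (cos_clamp_eventuallyEq hq.1 hq.2)
      have hΦ2 : HasDerivAt (fun q ↦ -Real.sin q) (-Real.cos T)
          ((fun (z : M) (_ : ℝ) ↦ (g.edist hg p z).toReal) (expMap g.leviCivita p (T • u)) t) := by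
        show HasDerivAt (fun q ↦ -Real.sin q) (-Real.cos T)
          (g.edist hg p (expMap g.leviCivita p (T • u))).toReal
        rw [hT]
        exact (Real.hasDerivAt_sin T).neg
      have hΦ'0 : (fun q ↦ -Real.sin q)
          ((fun (z : M) (_ : ℝ) ↦ (g.edist hg p z).toReal) (expMap g.leviCivita p (T • u)) t) ≤ 0 := by
        show -Real.sin (g.edist hg p (expMap g.leviCivita p (T • u))).toReal ≤ 0
        rw [hT]
        linarith
      have hΦineq : -(fun q ↦ -Real.sin q)
            ((fun (z : M) (_ : ℝ) ↦ (g.edist hg p z).toReal) (expMap g.leviCivita p (T • u)) t) *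
            (0 + ((m : ℝ) - 1) * (Real.cos T / Real.sin T)) - (2 * (1 / 2 : ℝ)) ^ 2 * (-Real.cos T) ≤
          (m : ℝ) * Φ ((fun (z : M) (_ : ℝ) ↦ (g.edist hg p z).toReal)
            (expMap g.leviCivita p (T • u)) t) := by
        show -(-Real.sin (g.edist hg p (expMap g.leviCivita p (T • u))).toReal) *
            (0 + ((m : ℝ) - 1) * (Real.cos T / Real.sin T)) - (2 * (1 / 2 : ℝ)) ^ 2 * (-Real.cos T) ≤
          (m : ℝ) * Φ (g.edist hg p (expMap g.leviCivita p (T • u))).toReal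
        rw [hT, hΦT]
        have hs0 : Real.sin T ≠ 0 := hsin.ne'
        have hL : -(-Real.sin T) * (0 + ((m : ℝ) - 1) * (Real.cos T / Real.sin T)) -
            (2 * (1 / 2 : ℝ)) ^ 2 * (-Real.cos T) = (m : ℝ) * Real.cos T := by
          field_simp
          ring
        rw [hL]
      obtain ⟨e, U, U', bu, Ut, pu, hon, hU, hUt', hsum⟩ :=
        directional_lower_barriers_of_antitone_comp (h := fun _ : ℝ ↦ g)
          (ψ := fun (z : M) (_ : ℝ) ↦ (g.edist hg p z).toReal) (Φ := Φ)
          (Φ' := fun q ↦ -Real.sin q) (Φ''₀ := -Real.cos T) (lam := (m : ℝ)) (t₁ := t₁)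
          (y := expMap g.leviCivita p (T • u)) (t := t) antitone_cos_clamp hΦ1 hΦ2 hΦ'0
          (S := ((m : ℝ) - 1) * (Real.cos T / Real.sin T)) (Pl := 0) (D := 1 / 2) hΦineq
          (by
            intro η₀ hη₀
            obtain ⟨e, B, B', b, i₀, hon, hB, hBi₀, hBi, hsumb⟩ :=
              far_end_edist_barriers_sin g hg hc hRic' p u hu hTpos hTπ' hη₀
            rw [hfr] at hsumb
            refine ⟨e, B, B', b, fun _ ↦ T, 0, i₀, hon, fun i ↦ ?_, by rw [hBi₀]; norm_num, hBi,
              ⟨(hasDerivAt_const t T).hasDerivWithinAt, hT.symm,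
                Eventually.of_forall fun _ ↦ hT.le⟩, hsumb, by linarith⟩
            obtain ⟨h1, h2, h3, h4⟩ := hB i
            exact ⟨h1, h2, h3.trans hT.symm, h4⟩)
          η hη
      refine ⟨e, U, U', bu, Ut, pu, hon, fun i ↦ ?_, ?_, hsum⟩
      · obtain ⟨h1, h2, h3, h4⟩ := hU i
        refine ⟨h1, h2, ?_, ?_⟩
        · rw [h3]
          show Real.exp (-(m : ℝ) * (t - t₁)) * Φ (g.edist hg p (expMap g.leviCivita p (T • u))).toReal = _
          rw [hΦd]
        · filter_upwards [h4] with σ hσ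
          refine hσ.trans_eq ?_
          show Real.exp (-(m : ℝ) * (t - t₁)) *
            Φ (g.edist hg p (expMap g.leviCivita (expMap g.leviCivita p (T • u)) (σ • e i))).toReal = _
          rw [hΦd]
      · obtain ⟨h1, h2, h3⟩ := hUt'
        refine ⟨h1, ?_, ?_⟩
        · rw [h2]
          show Real.exp (-(m : ℝ) * (t - t₁)) * Φ (g.edist hg p (expMap g.leviCivita p (T • u))).toReal = _
          rw [hΦd]
        · filter_upwards [h3] with t' ht'
          refine ht'.trans_eq ?_
          show Real.exp (-(m : ℝ) * (t' - t₁)) *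
            Φ (g.edist hg p (expMap g.leviCivita p (T • u))).toReal = _
          rw [hΦd]
    · /- ### the antipode `d(p, y) = π`: zero excess and the barriers `-c cos σ` -/
      -- zero excess: `d(p, z) = π - d(y, z)` for all `z`
      have hex : ∀ z : M, (g.edist hg p z).toReal = π - (g.edist hg y z).toReal := by
        intro z
        have hpq : ENNReal.ofReal (π - 0) ≤ g.edist hg p y := by
          rw [sub_zero, ← hTπ, ENNReal.ofReal_toReal (PseudoRiemannianMetric.edist_ne_top hg p y)]
        have hδm : (0 : ℝ) < π / (2 * m) :=
          div_pos Real.pi_pos (mul_pos two_pos (by exact_mod_cast hm0))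
        have h1 := excess_pow_le_of_edist_ge_pi_sub g hg hm hRic le_rfl hδm hpq z
        rw [mul_zero, hTπ] at h1
        have htri : π ≤ (g.edist hg p z).toReal + (g.edist hg z y).toReal := by
          letI := g.metricSpace hg
          have := dist_triangle p z y
          rwa [← hTπ]
        have h0 : (g.edist hg p z).toReal + (g.edist hg z y).toReal - π = 0 :=
          pow_eq_zero_iff (by omega : m ≠ 0) |>.1 (le_antisymm h1 (pow_nonneg (by linarith) m))
        rw [PseudoRiemannianMetric.edist_comm hg z y] at h0
        linarith
      obtain ⟨b, hb⟩ := g.exists_orthonormal_basis y hg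
      have hcosd : ∀ i, ∀ᶠ σ in 𝓝 (0 : ℝ),
          Real.cos (g.edist hg p (expMap g.leviCivita y (σ • b i))).toReal = -Real.cos σ := by
        intro i
        filter_upwards [eventually_edist_expMap_smul_eq_abs g hg hc y (b i) (by rw [hb]; simp)]
          with σ hσ
        rw [hex, hσ, Real.cos_pi_sub, Real.cos_abs]
      have hU1 : ∀ σ : ℝ, HasDerivAt (fun σ ↦ -c * Real.cos σ) (c * Real.sin σ) σ := fun σ ↦
        ((Real.hasDerivAt_cos σ).const_mul (-c)).congr_deriv (by ring)
      have hU2 : HasDerivAt (fun σ ↦ c * Real.sin σ) c 0 := by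
        simpa using (Real.hasDerivAt_sin (0 : ℝ)).const_mul c
      have hUt : HasDerivWithinAt
          (fun t' ↦ Real.exp (-(m : ℝ) * (t' - t₁)) * Real.cos (g.edist hg p y).toReal)
          ((m : ℝ) * c) (Iic t) t := by
        refine ((hder.mul_const (Real.cos (g.edist hg p y).toReal)).hasDerivWithinAt
          (s := Iic t)).congr_deriv ?_
        rw [hTπ, Real.cos_pi]
        ring
      refine ⟨fun i ↦ b i, fun _ σ ↦ -c * Real.cos σ, fun _ σ ↦ c * Real.sin σ, fun _ ↦ c,
        fun t' ↦ Real.exp (-(m : ℝ) * (t' - t₁)) * Real.cos (g.edist hg p y).toReal, (m : ℝ) * c,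
        hb, fun i ↦ ⟨Eventually.of_forall hU1, hU2,
          by simp only [hTπ, Real.cos_pi, Real.cos_zero]; ring, ?_⟩,
        ⟨hUt, rfl, Eventually.of_forall fun t' ↦ le_rfl⟩, ?_⟩
      · filter_upwards [hcosd i] with σ hσ
        rw [hσ]
        linarith
      · simp only [Finset.sum_const, Finset.card_univ, Fintype.card_fin, nsmul_eq_mul, hfr]
        linarith

/-- **Heat flow monotonicity: `τ ↦ e^{mτ} (P_τ cos d_p)(x)` is nondecreasing** (the integrated
form of `(Δ + m) P_τ cos d_p ≥ 0`; Colding 1996a, §1 / Colding 1997, sketch of the proof of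
Thm. 1.1, run through the heat flow): on a closed `m`-manifold, `m ≥ 2`, with `Ric ≥ (m-1) g`,
for the heat kernel measures `ν_{x,t;s}` of the static family `r ↦ g` and `s₁ < s₂ < t`,
  `e^{-m(s₂ - s₁)} ∫ cos d(p, ·) dν_{x,t;s₂} ≤ ∫ cos d(p, ·) dν_{x,t;s₁}`
(`integral_heatKernelMeasure_le_of_directionalBarrier_family` with `c = 0` and the datum
`cos_edist_heat_directional_datum`).
[cite: Colding1997Aspects, §1, sketch of proof of Thm. 1.1] [cite: Bamler2020Entropy, §2.3] -/
theorem exp_mul_integral_cos_edist_heatKernelMeasure_le (hg : g.IsRiemannian) (hm : 2 ≤ m)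
    (hRic : ∀ (x : M) (w : TangentSpace (𝓡 m) x), ((m : ℝ) - 1) * g.val x w w ≤ g.ricci x w w)
    (hh : IsContMDiffFamilyOn ∞ (fun _ : ℝ ↦ g) univ) (hR : ∀ _ : ℝ, g.IsRiemannian)
    (p x : M) {s₁ s₂ t : ℝ} (h12 : s₁ < s₂) (hs₂t : s₂ < t) :
    Real.exp (-(m : ℝ) * (s₂ - s₁)) *
        ∫ y, Real.cos (g.edist hg p y).toReal ∂(heatKernelMeasure hh hR t x s₂) ≤
      ∫ y, Real.cos (g.edist hg p y).toReal ∂(heatKernelMeasure hh hR t x s₁) := by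
  have hdc : Continuous fun y : M ↦ (g.edist hg p y).toReal :=
    ENNReal.continuousOn_toReal.comp_continuous
      ((PseudoRiemannianMetric.continuous_edist hg).comp (Continuous.prodMk_right p))
      fun y ↦ PseudoRiemannianMetric.edist_ne_top hg p y
  have hwc : ContinuousOn (fun q : M × ℝ ↦
      Real.exp (-(m : ℝ) * (q.2 - s₁)) * Real.cos (g.edist hg p q.1).toReal) (univ ×ˢ Icc s₁ s₂) :=
    ((Real.continuous_exp.comp (continuous_const.mul (continuous_snd.sub continuous_const))).mul
      (Real.continuous_cos.comp (hdc.comp continuous_fst))).continuousOn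
  have key := integral_heatKernelMeasure_le_of_directionalBarrier_family hh hR x h12 hs₂t
    (w := fun y r ↦ Real.exp (-(m : ℝ) * (r - s₁)) * Real.cos (g.edist hg p y).toReal) (c := 0)
    hwc (fun y r _ η hη ↦ cos_edist_heat_directional_datum g hg hm hRic p s₁ y r hη)
  simp only [zero_mul, add_zero, sub_self, mul_zero, Real.exp_zero, one_mul] at key
  rwa [integral_const_mul] at key

end Static

end Literature.Geometry.Riemannian

end
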